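import Mathlib
import Summits.KontsevichZagierPeriods.KontsevichZagierPeriods.Theorems.SoloInformedRealPeriodAlgebra
import Summits.KontsevichZagierPeriods.KontsevichZagierPeriods.Theorems.SoloInformedRealTensorGeneral
import Summits.KontsevichZagierPeriods.KontsevichZagierPeriods.Theorems.SoloInformedAlgebraicCoefficientDescent
import HarnessLib

/-!
# Solo-informed: on the real span `ℝ·P_ℚ ⊆ P_ℝ` of `ℚ`-data, `π`-cancellation IS `KZ.PiCancellation`

File of the solo-informed residency (s237), making KERNEL the clause (Q2) of `real-parameters.md`
(s224 addendum (S3)).  Notation: `P_ℝ = SoloInformedPeriodRingOver ℝ` (the commutative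
`ℝ`-algebra of real formal periods: formal `ℤ`-combinations of absolutely convergent integrals
with `ℝ`-semialgebraic data modulo the four Kontsevich–Zagier moves, file
`SoloInformedRealPeriodAlgebra`), `⟦π⟧ = soloInformedPiClassReal` (the class of the disc),
`ι = soloInformedRatToReal : KZ.FormalRep →+ P_ℝ` (a `ℚ`-datum read as an `ℝ`-datum),
`k = algebraicClosure ℚ ℝ` (real algebraic numbers), `ℝ·P_ℚ = soloInformedRatSpanReal` (the
`ℝ`-submodule of `P_ℝ` spanned by the image of `ι`).  "prep" = conditional on the vendored
Lion–Rolin preparation fact `semialgebraicPreparation` only (as THEOREM T / T⊗).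

Main statements:

* `soloInformedAlgScaleRep` / `soloInformedAlgScale` — **real ALGEBRAIC scalars act on `ℚ`-data**:
  `a • [σ, f] = [σ, a·f]` is again a `ℚ`-datum for `a ∈ ℝ ∩ ℚ̄` (a `ℚ`-definable constant;
  `soloInformed_isSemialgebraic_rat_of_integralClosure`), and base change to `ℝ` turns it into
  integrand scaling: `soloInformed_baseChange_algScale`; on classes `a • ι c = ι (a • c)`
  (`soloInformed_smul_ratToReal_of_isAlgebraic`).
* `soloInformed_exists_linIndep_form` — **basis normal form**: every element `∑ᵢ sᵢ • ι(qᵢ)` of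
  `ℝ·P_ℚ` equals `∑ⱼ cⱼ • ι(Qⱼ)` with `c` linearly independent over `k` (choose a `k`-basis of
  `span_k {sᵢ}` and fold the algebraic coordinates into the `ℚ`-data).
* `soloInformed_ratSpan_linIndep_eq_zero_iff_prep` — THEOREM T⊗ in `P_ℝ`: for `c` `k`-linearly
  independent, `∑ⱼ cⱼ • ι(Qⱼ) = 0 ↔ every Qⱼ ∈ KZ.relations` (prep).
* `soloInformed_ratSpan_cancel_of_piCancellation_prep` — **(Q2)**: granting `KZ.PiCancellation`,
  `⟦π⟧ · x = 0 → x = 0` for every `x ∈ ℝ·P_ℚ` (prep): `⟦π⟧·` on `ℝ·P_ℚ ≅ ℝ ⊗_k P_ℚ` is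
  `1 ⊗ (⟦π⟧·)`.
* `soloInformed_piCancellationRealOnRatSpan_iff_prep`, `soloInformed_piCancellation_iff_ratSpanReal_prep`
  — **`Q_ℝ` restricted to `ℝ·P_ℚ` is EXACTLY `KZ.PiCancellation`** (prep); unconditionally
  `Q_ℝ ⇒ Q_ℝ|ℝ·P_ℚ` (`soloInformed_piCancellationRealOnRatSpan_of_real`).
* `soloInformed_exists_piCancellation_witness_of_ratSpan_prep` — **a witness against `Q_ℝ` inside
  `ℝ·P_ℚ` is a witness against `KZ.PiCancellation`** (prep): the extra content of the open
  question `Q_ℝ` over residual (2) lives in `P_ℝ ∖ ℝ·P_ℚ` (genuinely real-parametric data).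

Nothing is asserted about `Q_ℝ` or `KZ.PiCancellation` themselves (both OPEN).

References: M. Kontsevich, D. Zagier, *Periods* (2001), §1.2, §4.1; S. Basu, R. Pollack,
M.-F. Roy, *Algorithms in Real Algebraic Geometry* (2006), Thm. 2.77 / Cor. 2.78 (real algebraic
numbers are `ℚ`-definable); J.-M. Lion, J.-P. Rolin (1998) (preparation).
-/

noncomputable section

open Set MeasureTheory MvPolynomial
open Literature.ModelTheory.ExponentialFields Literature.NumberTheory.Transcendental KZ

namespace Summit.KontsevichZagierPeriods.KontsevichZagierPeriods.Theorems

variable {n : ℕ}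

/-! ### Real algebraic scalars act on `ℚ`-data -/

/-- **Integrand scaling of a `ℚ`-datum by a real algebraic number**: `a • [σ, f] = [σ, a · f]`,
again an integral representation with `ℚ`-semialgebraic data — the graph of `a · f` is
semialgebraic over the ring `ℝ ∩ ℚ̄` of real algebraic numbers, hence `ℚ`-semialgebraic
(`soloInformed_isSemialgebraic_rat_of_integralClosure`: a real algebraic constant is
`ℚ`-definable). -/
def soloInformedAlgScaleRep {a : ℝ} (ha : IsAlgebraic ℚ a) (r : KZOver.IntegralRep ℚ n) :
    KZOver.IntegralRep ℚ n where
  domain := r.domain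
  integrand x := a * r.integrand x
  isSemialgebraic_domain := r.isSemialgebraic_domain
  isSemialgebraicFunOn_integrand := by
    have haK : a ∈ integralClosure ℚ ℝ := (mem_integralClosure_iff ℚ ℝ).2 ha.isIntegral
    have h1 : IsSemialgebraicFunOn (integralClosure ℚ ℝ) r.domain (fun x => a * r.integrand x) :=
      IsSemialgebraicFunOn.mul_holds
        ((isSemialgebraicFunOn_aeval (r.isSemialgebraic_domain.baseChange (integralClosure ℚ ℝ))
            (C (⟨a, haK⟩ : integralClosure ℚ ℝ) :
              MvPolynomial (Fin n) (integralClosure ℚ ℝ))).congr fun x _ => by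
          dsimp only; rw [MvPolynomial.aeval_C]; rfl)
        (r.isSemialgebraicFunOn_integrand.baseChange (integralClosure ℚ ℝ))
    exact soloInformed_isSemialgebraic_rat_of_integralClosure h1
  integrableOn := r.integrableOn.integrable.const_mul a

/-- The domain of `a • r` is the domain of `r`. -/
@[simp] theorem soloInformed_algScaleRep_domain {a : ℝ} (ha : IsAlgebraic ℚ a)
    (r : KZOver.IntegralRep ℚ n) : (soloInformedAlgScaleRep ha r).domain = r.domain := rfl

/-- The integrand of `a • r` is `a · f`. -/
@[simp] theorem soloInformed_algScaleRep_integrand {a : ℝ} (ha : IsAlgebraic ℚ a)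
    (r : KZOver.IntegralRep ℚ n) (x : Fin n → ℝ) :
    (soloInformedAlgScaleRep ha r).integrand x = a * r.integrand x := rfl

/-- `value (a • r) = a · value r`. -/
theorem soloInformed_algScaleRep_value {a : ℝ} (ha : IsAlgebraic ℚ a)
    (r : KZOver.IntegralRep ℚ n) : (soloInformedAlgScaleRep ha r).value = a * r.value := by
  simp only [KZOver.IntegralRep.value, soloInformed_algScaleRep_integrand,
    soloInformed_algScaleRep_domain]
  exact integral_const_mul a r.integrand

/-- **Base change turns algebraic scaling of `ℚ`-data into real integrand scaling**:
`(a • r) ⊗ ℝ = a • (r ⊗ ℝ)` on representations (same domain, same integrand). -/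
theorem soloInformed_algScaleRep_baseChange {a : ℝ} (ha : IsAlgebraic ℚ a)
    (r : KZOver.IntegralRep ℚ n) :
    (soloInformedAlgScaleRep ha r).baseChange ℝ = soloInformedRealScaleRep a (r.baseChange ℝ) :=
  KZOver.IntegralRep.ext rfl rfl

/-- **Algebraic scaling on formal combinations of `ℚ`-data**: the additive endomorphism of
`FormalRep ℚ` induced by `soloInformedAlgScaleRep` on generators. -/
def soloInformedAlgScale {a : ℝ} (ha : IsAlgebraic ℚ a) :
    KZOver.FormalRep ℚ →+ KZOver.FormalRep ℚ :=
  FreeAbelianGroup.map fun r => ⟨r.1, soloInformedAlgScaleRep ha r.2⟩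

/-- `algScale` on a generator. -/
@[simp] theorem soloInformed_algScale_of {a : ℝ} (ha : IsAlgebraic ℚ a)
    (r : KZOver.IntegralRep ℚ n) :
    soloInformedAlgScale ha (KZOver.of r) = KZOver.of (soloInformedAlgScaleRep ha r) := rfl

/-- **`(a • q) ⊗ ℝ = a • (q ⊗ ℝ)`** on formal combinations: base change intertwines algebraic
scaling of `ℚ`-data with real integrand scaling `soloInformedRealScale`. -/
theorem soloInformed_baseChange_algScale {a : ℝ} (ha : IsAlgebraic ℚ a)
    (q : KZOver.FormalRep ℚ) :
    KZOver.baseChange ℚ ℝ (soloInformedAlgScale ha q) =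
      soloInformedRealScale a (KZOver.baseChange ℚ ℝ q) := by
  have h : (KZOver.baseChange ℚ ℝ).comp (soloInformedAlgScale ha) =
      (soloInformedRealScale a).comp (KZOver.baseChange ℚ ℝ) :=
    FreeAbelianGroup.lift_ext _ _ fun ⟨m, r⟩ => by
      change KZOver.baseChange ℚ ℝ (soloInformedAlgScale ha (KZOver.of r)) =
        soloInformedRealScale a (KZOver.baseChange ℚ ℝ (KZOver.of r))
      rw [soloInformed_algScale_of, KZOver.baseChange_of, KZOver.baseChange_of,
        soloInformed_realScale_of, soloInformed_algScaleRep_baseChange]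
  exact DFunLike.congr_fun h q

/-! ### The `ℚ`-data line `ι : KZ.FormalRep →+ P_ℝ` -/

/-- **A `ℚ`-datum read as a real formal period**: `ι c = ⟦c ⊗ ℝ⟧ ∈ P_ℝ`, the composite of
`KZ.FormalRep ≃+ FormalRep ℚ`, base change to `ℝ` and the class map. -/
def soloInformedRatToReal : KZ.FormalRep →+ SoloInformedPeriodRingOver ℝ :=
  ((soloInformedToPeriodOver ℝ).toAddMonoidHom.comp (KZOver.baseChange ℚ ℝ)).comp
    KZOver.equivKZ.toAddMonoidHom

/-- Unfolding `ι`. -/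
theorem soloInformed_ratToReal_apply (c : KZ.FormalRep) :
    soloInformedRatToReal c =
      soloInformedToPeriodOver ℝ (KZOver.baseChange ℚ ℝ (KZOver.equivKZ c)) := rfl

/-- **`ι c = 0 ↔ c ∈ KZ.relations`** (prep): THEOREM T, `P_ℚ ↪ P_ℝ`. -/
theorem soloInformed_ratToReal_eq_zero_iff_prep (hprep : semialgebraicPreparation)
    (c : KZ.FormalRep) : soloInformedRatToReal c = 0 ↔ c ∈ KZ.relations := by
  rw [soloInformed_ratToReal_apply, soloInformed_toPeriodOver_eq_zero_iff,
    soloInformed_kz_baseChange_mem_relations_iff_prep hprep]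

/-- **`⟦π⟧ · ι c = ι ([π] · c)`**: the real disc class multiplies `ℚ`-data as KZ's `[π] ·`. -/
theorem soloInformed_piClassReal_mul_ratToReal (c : KZ.FormalRep) :
    soloInformedPiClassReal * soloInformedRatToReal c =
      soloInformedRatToReal (KZ.of KZ.piRep * c) := by
  rw [soloInformed_ratToReal_apply, soloInformed_ratToReal_apply,
    soloInformed_piClassReal_mul_toPeriodOver, soloInformed_discMul_baseChange_equivKZ]

/-- **`a • ι c = ι (a • c)` for real ALGEBRAIC `a`**: on the `ℚ`-data line, algebraic real
scalars are absorbed into the data. -/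
theorem soloInformed_smul_ratToReal_of_isAlgebraic {a : ℝ} (ha : IsAlgebraic ℚ a)
    (c : KZ.FormalRep) :
    a • soloInformedRatToReal c =
      soloInformedRatToReal (KZOver.equivKZ.symm (soloInformedAlgScale ha (KZOver.equivKZ c))) := by
  rw [soloInformed_ratToReal_apply, soloInformed_ratToReal_apply, AddEquiv.apply_symm_apply,
    soloInformed_real_smul_toPeriodOver, soloInformed_baseChange_algScale]

/-- A real-scalar combination of `ℚ`-data read through the class map:
`∑ⱼ cⱼ • ι(Qⱼ) = ⟦∑ⱼ cⱼ • (Qⱼ ⊗ ℝ)⟧` (real scalars act by integrand scaling). -/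
theorem soloInformed_sum_smul_ratToReal_eq_toPeriodOver {N : ℕ} (c : Fin N → ℝ)
    (Q : Fin N → KZ.FormalRep) :
    ∑ j, c j • soloInformedRatToReal (Q j) =
      soloInformedToPeriodOver ℝ
        (∑ j, soloInformedRealScale (c j) (KZOver.baseChange ℚ ℝ (KZOver.equivKZ (Q j)))) := by
  rw [map_sum]
  exact Finset.sum_congr rfl fun j _ => by
    rw [soloInformed_ratToReal_apply, soloInformed_real_smul_toPeriodOver]

/-! ### THEOREM T⊗ in `P_ℝ` -/

/-- **THEOREM T⊗ in `P_ℝ`** (prep): for a real scalar tuple `c` linearly independent over the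
real algebraic numbers and `ℚ`-data `Qⱼ`, `∑ⱼ cⱼ • ι(Qⱼ) = 0 ↔ ∀ j, Qⱼ ∈ KZ.relations`
(`soloInformed_realTensor_linIndep_iff_prep` read in the ring `P_ℝ`).
[cite: KontsevichZagier2001, §1.2] -/
theorem soloInformed_ratSpan_linIndep_eq_zero_iff_prep (hprep : semialgebraicPreparation) {N : ℕ}
    {c : Fin N → ℝ} (hc : LinearIndependent (algebraicClosure ℚ ℝ) c)
    (Q : Fin N → KZ.FormalRep) :
    ∑ j, c j • soloInformedRatToReal (Q j) = 0 ↔ ∀ j, Q j ∈ KZ.relations := by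
  rw [soloInformed_sum_smul_ratToReal_eq_toPeriodOver, soloInformed_toPeriodOver_eq_zero_iff,
    soloInformed_realTensor_linIndep_iff_prep hprep hc]
  exact forall_congr' fun j => KZOver.equivKZ_mem_relations_iff (Q j)

/-! ### Basis normal form of an element of `ℝ·P_ℚ` -/

/-- **Basis normal form.** Every real-scalar combination `∑ᵢ sᵢ • ι(qᵢ)` of `ℚ`-data equals a
combination `∑ⱼ cⱼ • ι(Qⱼ)` whose scalars `c` are linearly independent over the field
`k = algebraicClosure ℚ ℝ` of real algebraic numbers: take a `k`-basis `c` of `span_k {sᵢ}`,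
write `sᵢ = ∑ⱼ aᵢⱼ cⱼ` with `aᵢⱼ ∈ k`, and fold the algebraic coordinates into the data,
`Qⱼ = ∑ᵢ aᵢⱼ • qᵢ` (`soloInformed_smul_ratToReal_of_isAlgebraic`).  Unconditional. -/
theorem soloInformed_exists_linIndep_form {ι : Type*} [Fintype ι] (s : ι → ℝ)
    (q : ι → KZ.FormalRep) :
    ∃ (N : ℕ) (c : Fin N → ℝ) (Q : Fin N → KZ.FormalRep),
      LinearIndependent (algebraicClosure ℚ ℝ) c ∧
        ∑ i, s i • soloInformedRatToReal (q i) = ∑ j, c j • soloInformedRatToReal (Q j) := by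
  classical
  let V : Submodule (algebraicClosure ℚ ℝ) ℝ :=
    Submodule.span (algebraicClosure ℚ ℝ) (Set.range s)
  haveI : FiniteDimensional (algebraicClosure ℚ ℝ) V :=
    FiniteDimensional.span_of_finite (algebraicClosure ℚ ℝ) (Set.finite_range s)
  let B := Module.finBasis (algebraicClosure ℚ ℝ) V
  have hmem : ∀ i, s i ∈ V := fun i => Submodule.subset_span ⟨i, rfl⟩
  let a : ι → Fin (Module.finrank (algebraicClosure ℚ ℝ) V) → algebraicClosure ℚ ℝ :=
    fun i j => B.repr ⟨s i, hmem i⟩ j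
  have ha : ∀ i j, IsAlgebraic ℚ ((a i j : algebraicClosure ℚ ℝ) : ℝ) := fun i j =>
    mem_algebraicClosure_iff.1 (a i j).2
  have hs : ∀ i, s i = ∑ j, ((a i j : algebraicClosure ℚ ℝ) : ℝ) * ((B j : V) : ℝ) := fun i => by
    have h := congrArg V.subtype (B.sum_repr ⟨s i, hmem i⟩)
    rw [map_sum] at h
    simp only [map_smul, Submodule.subtype_apply, IntermediateField.smul_def, smul_eq_mul] at h
    exact h.symm
  refine ⟨Module.finrank (algebraicClosure ℚ ℝ) V, fun j => ((B j : V) : ℝ),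
    fun j => ∑ i, KZOver.equivKZ.symm (soloInformedAlgScale (ha i j) (KZOver.equivKZ (q i))),
    ?_, ?_⟩
  · simpa [Function.comp_def] using B.linearIndependent.map' V.subtype V.ker_subtype
  · calc ∑ i, s i • soloInformedRatToReal (q i)
        = ∑ i, ∑ j, (((a i j : algebraicClosure ℚ ℝ) : ℝ) * ((B j : V) : ℝ)) •
            soloInformedRatToReal (q i) :=
          Finset.sum_congr rfl fun i _ => by rw [← Finset.sum_smul, ← hs i]
      _ = ∑ j, ∑ i, ((B j : V) : ℝ) •
            ((((a i j : algebraicClosure ℚ ℝ) : ℝ)) • soloInformedRatToReal (q i)) := by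
          rw [Finset.sum_comm]
          exact Finset.sum_congr rfl fun j _ => Finset.sum_congr rfl fun i _ => by
            rw [mul_comm, mul_smul]
      _ = ∑ j, ((B j : V) : ℝ) • soloInformedRatToReal
            (∑ i, KZOver.equivKZ.symm (soloInformedAlgScale (ha i j) (KZOver.equivKZ (q i)))) :=
          Finset.sum_congr rfl fun j _ => by
            rw [← Finset.smul_sum, map_sum]
            exact congrArg _ (Finset.sum_congr rfl fun i _ =>
              soloInformed_smul_ratToReal_of_isAlgebraic (ha i j) (q i))

/-! ### (Q2): `π`-cancellation on `ℝ·P_ℚ` is `KZ.PiCancellation` -/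

/-- **(Q2)** (prep). Granting `KZ.PiCancellation`, the disc class cancels on every real-scalar
combination of `ℚ`-data: `⟦π⟧ · ∑ᵢ sᵢ • ι(qᵢ) = 0 → ∑ᵢ sᵢ • ι(qᵢ) = 0`.  Proof: pass to the
basis normal form `∑ⱼ cⱼ • ι(Qⱼ)`; `⟦π⟧ · ι(Qⱼ) = ι([π]·Qⱼ)`; THEOREM T⊗ gives `[π]·Qⱼ ∈
KZ.relations` for every `j`, `KZ.PiCancellation` gives `Qⱼ ∈ KZ.relations`, so every
`ι(Qⱼ) = 0`.  (`⟦π⟧·` on `ℝ·P_ℚ ≅ ℝ ⊗_k P_ℚ` is `1 ⊗ ([π]·)`; `ℝ` is free over `k`.)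
[cite: KontsevichZagier2001, §4.1] -/
theorem soloInformed_ratSpan_cancel_of_piCancellation_prep (hprep : semialgebraicPreparation)
    (hpc : PiCancellation) {ι : Type*} [Fintype ι] (s : ι → ℝ) (q : ι → KZ.FormalRep)
    (h : soloInformedPiClassReal * ∑ i, s i • soloInformedRatToReal (q i) = 0) :
    ∑ i, s i • soloInformedRatToReal (q i) = 0 := by
  obtain ⟨N, c, Q, hc, hx⟩ := soloInformed_exists_linIndep_form s q
  rw [hx] at h ⊢
  rw [Finset.mul_sum] at h
  simp_rw [mul_smul_comm, soloInformed_piClassReal_mul_ratToReal] at h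
  have hQ := (soloInformed_ratSpan_linIndep_eq_zero_iff_prep hprep hc _).1 h
  refine Finset.sum_eq_zero fun j _ => ?_
  rw [(soloInformed_ratToReal_eq_zero_iff_prep hprep (Q j)).2 (hpc _ (hQ j)), smul_zero]

/-- **`π`-cancellation on the real span of `ℚ`-data** — the question `Q_ℝ` restricted to
`ℝ·P_ℚ ⊆ P_ℝ`: for all real scalar tuples `s` and `ℚ`-data `q`,
`⟦π⟧ · ∑ᵢ sᵢ • ι(qᵢ) = 0 → ∑ᵢ sᵢ • ι(qᵢ) = 0`.
(Posed by this file as a definition / open statement of the residency; not a result in print.) -/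
def SoloInformedPiCancellationRealOnRatSpan : Prop :=
  ∀ (M : ℕ) (s : Fin M → ℝ) (q : Fin M → KZ.FormalRep),
    soloInformedPiClassReal * ∑ i, s i • soloInformedRatToReal (q i) = 0 →
      ∑ i, s i • soloInformedRatToReal (q i) = 0

/-- **`Q_ℝ|ℝ·P_ℚ ⟺ KZ.PiCancellation`** (prep): on real combinations of `ℚ`-data the real
cancellation question is EXACTLY residual (2).  (`⇒`: one `ℚ`-datum with scalar `1`, through
`P_ℚ ↪ P_ℝ`; `⇐`: `soloInformed_ratSpan_cancel_of_piCancellation_prep`.)  This refines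
`soloInformed_piCancellationRealOnRat_iff_prep` (file `SoloInformedRealDiscTransfer`) from
`ℚ`-data to real combinations of `ℚ`-data. [cite: KontsevichZagier2001, §4.1] -/
theorem soloInformed_piCancellationRealOnRatSpan_iff_prep (hprep : semialgebraicPreparation) :
    SoloInformedPiCancellationRealOnRatSpan ↔ PiCancellation := by
  constructor
  · intro h c hc
    have h1 := h 1 (fun _ => 1) (fun _ => c)
    simp only [Fin.sum_univ_one, one_smul] at h1
    rw [soloInformed_piClassReal_mul_ratToReal, soloInformed_ratToReal_eq_zero_iff_prep hprep,
      soloInformed_ratToReal_eq_zero_iff_prep hprep] at h1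
    exact h1 hc
  · intro hpc M s q h
    exact soloInformed_ratSpan_cancel_of_piCancellation_prep hprep hpc s q h

/-- **`Q_ℝ ⇒ Q_ℝ|ℝ·P_ℚ`** (unconditional): real `π`-cancellation in full implies it on the real
span of `ℚ`-data. -/
theorem soloInformed_piCancellationRealOnRatSpan_of_real (h : SoloInformedPiCancellationReal) :
    SoloInformedPiCancellationRealOnRatSpan := fun _ _ _ hx =>
  soloInformed_piCancellationReal_iff_forall_mul_eq_zero.1 h _ hx

/-! ### The submodule `ℝ·P_ℚ` -/

/-- **`ℝ·P_ℚ ⊆ P_ℝ`**: the `ℝ`-submodule of real formal periods spanned by the classes of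
`ℚ`-data (the image of `P_ℚ ⊗_k ℝ → P_ℝ`, injective by THEOREM T⊗). -/
def soloInformedRatSpanReal : Submodule ℝ (SoloInformedPeriodRingOver ℝ) :=
  Submodule.span ℝ (Set.range soloInformedRatToReal)

/-- `ι c ∈ ℝ·P_ℚ`. -/
theorem soloInformed_ratToReal_mem_ratSpanReal (c : KZ.FormalRep) :
    soloInformedRatToReal c ∈ soloInformedRatSpanReal :=
  Submodule.subset_span ⟨c, rfl⟩

/-- Real-scalar combinations of `ℚ`-data lie in `ℝ·P_ℚ`. -/
theorem soloInformed_sum_smul_ratToReal_mem_ratSpanReal {ι : Type*} [Fintype ι] (s : ι → ℝ)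
    (q : ι → KZ.FormalRep) :
    ∑ i, s i • soloInformedRatToReal (q i) ∈ soloInformedRatSpanReal :=
  Submodule.sum_mem _ fun i _ =>
    Submodule.smul_mem _ _ (soloInformed_ratToReal_mem_ratSpanReal (q i))

/-- **Elements of `ℝ·P_ℚ` are finite real-scalar combinations of `ℚ`-data.** -/
theorem soloInformed_mem_ratSpanReal_iff (x : SoloInformedPeriodRingOver ℝ) :
    x ∈ soloInformedRatSpanReal ↔
      ∃ (M : ℕ) (s : Fin M → ℝ) (q : Fin M → KZ.FormalRep),
        x = ∑ i, s i • soloInformedRatToReal (q i) := by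
  classical
  constructor
  · intro hx
    obtain ⟨l, hl⟩ := (Finsupp.mem_span_range_iff_exists_finsupp.1 hx)
    let e : Fin l.support.card ≃ l.support := l.support.equivFin.symm
    refine ⟨l.support.card, fun a => l (e a), fun a => (e a : KZ.FormalRep), ?_⟩
    rw [← hl, Finsupp.sum, ← Finset.sum_coe_sort]
    exact Fintype.sum_equiv e.symm _ _ fun b => by simp [e]
  · rintro ⟨M, s, q, rfl⟩
    exact soloInformed_sum_smul_ratToReal_mem_ratSpanReal s q

/-- **`KZ.PiCancellation ⟺ ⟦π⟧` cancels on `ℝ·P_ℚ`** (prep): residual (2) of the verdict is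
exactly the statement that the disc class is a non-zero-divisor ON THE SUBMODULE `ℝ·P_ℚ` of
`P_ℝ`; the open question `Q_ℝ` asks it on all of `P_ℝ`. [cite: KontsevichZagier2001, §4.1] -/
theorem soloInformed_piCancellation_iff_ratSpanReal_prep (hprep : semialgebraicPreparation) :
    PiCancellation ↔
      ∀ x ∈ soloInformedRatSpanReal, soloInformedPiClassReal * x = 0 → x = 0 := by
  constructor
  · intro hpc x hx h
    obtain ⟨M, s, q, rfl⟩ := (soloInformed_mem_ratSpanReal_iff x).1 hx
    exact soloInformed_ratSpan_cancel_of_piCancellation_prep hprep hpc s q h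
  · intro h c hc
    have h1 : soloInformedPiClassReal * soloInformedRatToReal c = 0 := by
      rw [soloInformed_piClassReal_mul_ratToReal, soloInformed_ratToReal_eq_zero_iff_prep hprep]
      exact hc
    exact (soloInformed_ratToReal_eq_zero_iff_prep hprep c).1
      (h _ (soloInformed_ratToReal_mem_ratSpanReal c) h1)

/-- **A witness against `Q_ℝ` inside `ℝ·P_ℚ` is a witness against `KZ.PiCancellation`**
(prep): if `x ∈ ℝ·P_ℚ`, `x ≠ 0` and `⟦π⟧ · x = 0`, then some `ℚ`-datum `c` has `[π] · c ∈
KZ.relations` and `c ∉ KZ.relations`.  So whatever distinguishes `Q_ℝ` from residual (2) lies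
in `P_ℝ ∖ ℝ·P_ℚ`. [cite: KontsevichZagier2001, §4.1] -/
theorem soloInformed_exists_piCancellation_witness_of_ratSpan_prep
    (hprep : semialgebraicPreparation) {x : SoloInformedPeriodRingOver ℝ}
    (hx : x ∈ soloInformedRatSpanReal) (h0 : soloInformedPiClassReal * x = 0) (hne : x ≠ 0) :
    ∃ c : KZ.FormalRep, KZ.of KZ.piRep * c ∈ KZ.relations ∧ c ∉ KZ.relations := by
  by_contra hcon
  push Not at hcon
  exact hne ((soloInformed_piCancellation_iff_ratSpanReal_prep hprep).1 hcon x hx h0)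

/-- **The two cancellation statements side by side** (prep): `Q_ℝ` (all of `P_ℝ`) implies
`KZ.PiCancellation` (= `Q_ℝ` on `ℝ·P_ℚ`); the converse is not claimed — its content would be
cancellation on real-parametric data outside `ℝ·P_ℚ`. -/
theorem soloInformed_piCancellationReal_imp_and_iff_prep (hprep : semialgebraicPreparation) :
    (SoloInformedPiCancellationReal → PiCancellation) ∧
      (SoloInformedPiCancellationRealOnRatSpan ↔ PiCancellation) :=
  ⟨fun h => (soloInformed_piCancellationRealOnRatSpan_iff_prep hprep).1
      (soloInformed_piCancellationRealOnRatSpan_of_real h),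
    soloInformed_piCancellationRealOnRatSpan_iff_prep hprep⟩

end Summit.KontsevichZagierPeriods.KontsevichZagierPeriods.Theorems
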